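import Literature.Analysis.FluidPDE.TaoForcedNormalisedPressure
import Literature.Analysis.FluidPDE.PressureRepresentation
import Literature.Analysis.FluidPDE.NewtonPotentialRepresentation
import Literature.Analysis.FluidPDE.HelmholtzAnnihilator
import Mathlib.Analysis.SpecialFunctions.JapaneseBracket
import HarnessLib

/-!
# The force potential `Δ⁻¹∇·f` of a smooth square-integrable force on `ℝ³`:
# near/far representation, `C²` regularity and the Poisson equation `Δ(Δ⁻¹∇·f) = ∇·f`

Analysis/FluidPDE support file (everything PROVED; no facts, no `sorry`) for the forced twins of
Tao's pressure-normalisation and energy statements (`TaoForcedNormalisedPressure.lean`: Tao 2011,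
arXiv:1108.1165, (9) `p = -Δ⁻¹∂ᵢ∂ⱼ(uᵢuⱼ) + Δ⁻¹∇·f`; Lemma 4.1 (i) = arXiv Lemma 25 (i), corrected
form `tao2011_forced_pressure_normalisation_ae`; Lemma 8.1 = arXiv Lemma 44). The tree's force
potential is the absolutely convergent integral

  `forcePotential f x = ∫ forceKernel (x - y) (f y) dy = ∫ ⟨x - y, f(y)⟩/(4π|x - y|³) dy = ∫ DΓ(x - y)(f y) dy`

(`Γ = -1/(4π|z|)` the Newtonian kernel of `NewtonKernel`). For a force SLICE `f ∈ C^k(ℝ³; ℝ³)`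
of finite energy `∫|f|² < ∞` — Tao's finite-energy data at a fixed time; NO decay of derivatives
and NO compact support is assumed (the compactly supported `L^p` case is `DivFormPotential`, the
compactly supported gradient case `forcePotential_gradient_eq_self`) — this file proves, along the
near/far splitting `Γ = Γ₀ + Γ∞` of the tree (`NewtonKernel`/`NewtonPotential`, cutoff radii
`(1, 2)`; the architecture is that of `PressureRepresentation` for `-Δ⁻¹∂ᵢ∂ⱼ(uᵢuⱼ)`, with the
`L¹` tensor `u ⊗ u` replaced by the `L²` vector `f`):

* `ForcePotential.forcePotential_eq_potential` — **`Δ⁻¹∇·f = Φ₀[f] + Φ∞[f]`** with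
  `Φ₀[f](x) = Σⱼ ∫ ∂ⱼΓ₀(z) fⱼ(x - z) dz` (`∂ⱼΓ₀ ∈ L¹_c`, `integrable_fderiv_newtonNear_apply`) and
  `Φ∞[f](x) = Σⱼ ∫ ∂ⱼΓ∞(x - y) fⱼ(y) dy` (`∂ⱼΓ∞` smooth with `|∂ⱼΓ∞|, |D∂ⱼΓ∞|, |D²∂ⱼΓ∞| ≲ ⟨z⟩⁻²`,
  `farKernel_tail`, against `fⱼ ∈ L²`: Cauchy–Schwarz with `⟨·⟩⁻² ∈ L²(ℝ³)`), for `f`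
  continuous with `f ∈ L²`;
* `contDiff_forcePotential` — **`Δ⁻¹∇·f ∈ C²`** for `f ∈ C² ∩ L²` (near part: differentiation
  under the integral against the `L¹` kernels, `HarmonicProbe.contDiff_integral_smul_comp_sub`;
  far part: the square-integrable tail-kernel lemmas `contDiff_two_integral_tail_mul` /
  `laplacian_integral_tail_mul` proved here, the `L²` counterpart of the bounded-kernel /
  `L¹`-weight lemmas of `PressureRepresentation`);
* `laplacian_forcePotential` — **`Δ(Δ⁻¹∇·f) = ∇·f`** pointwise for `f ∈ C³ ∩ L²`
  (Gilbarg–Trudinger (2.17) and Lemma 4.2: `Δ(Γ * g) = g`): `ΔΦ₀[f] = div f - Σⱼ ∫ ∂ⱼλ(z) fⱼ(x-z) dz`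
  (`laplacian_nearPart_eq`: Laplacian under the integral, the integration by parts
  `∫ ∂ₐΓ₀ ψ = -∫ Γ₀ ∂ₐψ` for the singular `W^{1,1}` kernel `Γ₀` and arbitrary `ψ ∈ C¹`
  (`integral_fderiv_newtonNear_mul`, from the tree's distributional identity
  `BiotSavartNewtonKernel.integral_newtonKernel_smul_fderiv_eq`), `Σⱼ ∂ⱼΔfⱼ = Δ div f`, the
  localised Green identity `∫ Γ₀ Δφ = φ(0) - ∫ λφ` (`NewtonPotential.integral_newtonNear_mul_laplacian`,
  `λ = ΔΓ∞`) and integration by parts against the smooth `λ`), and `ΔΦ∞[f] = Σⱼ ∫ ∂ⱼλ(x-y) fⱼ(y) dy`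
  (`laplacian_farPart`: `Δ∂ⱼΓ∞ = ∂ⱼΔΓ∞`, `HelmholtzAnnihilator.fderiv_laplacian_apply`); the
  `λ`-terms cancel after `z = x - y`.

Auxiliary, of independent use: `decay_of_homogeneous` (quantitative decay `‖Φ(z)‖ ≤ C|z|⁻²` of a
function homogeneous of degree `≤ -2`), `exists_le_mul_jbw`, `newtonKernelGrad_homogeneous`,
`contDiffOn_newtonKernelGrad`, `divergence_eq_sum_coord` (`div f = Σⱼ ∂ⱼfⱼ`).

## Mathlib / tree search

Tree (all used): `forcePotential`, `forceKernel_eq_fin3` (`TaoForcedNormalisedPressure`);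
`newtonKernel`, `newtonNear`, `newtonFar`, `newtonFarLaplacian`, `radialCutoff`,
`fderiv_newtonKernel_apply`, `norm_fderiv_newtonKernel`, `abs_newtonKernel`, `contDiff_newtonFar`,
`newtonFar_eventuallyEq_newtonKernel`, `fderiv_homogeneous`, `newtonNear_eq_sub` (`NewtonKernel`);
`integrable_newtonNear`, `integral_newtonNear_mul_laplacian`, `contDiff_newtonFarLaplacian`,
`hasCompactSupport_newtonFarLaplacian` (`NewtonPotential`); `contDiff_integral_smul_comp_sub`,
`laplacian_integral_mul_comp_sub`, `integral_fderiv_mul_comp_sub`, `fderiv_comp_const_sub`,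
`laplacian_comp_const_sub` (`HarmonicProbe`); `NewtonPotentialHolder.newtonKernelGrad`,
`integrableOn_ball_norm_rpow_neg`, `newtonKernelGrad_eq_fderiv`; `integral_newtonKernel_smul_fderiv_eq`,
`fderiv_newtonKernel_zero` (`BiotSavartNewtonKernel`); `integrable_newtonKernel_mul`
(`NormalisedPressureL2Bound`); `fderiv_laplacian_apply` (`HelmholtzAnnihilator`);
`laplacian_eq_sum_fderiv_fderiv`, `integral_fderiv_apply_eq_zero`, `continuous_laplacian`
(`WholeSpaceIBP`); `contDiff_laplacian` (`NewtonKernel`). No prior `Δ⁻¹∇·` regularity for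
non-compactly-supported `L²` forces in the tree (`lean search 'forcePotential'`: definition and the
gradient case only). Mathlib: `hasFDerivAt_integral_of_dominated_of_fderiv_le`,
`integrable_one_add_norm`, `MemLp.integrable_mul`, `Measure.measurePreserving_sub_left`,
`integral_sub_left_eq_self`, `iteratedFDeriv_sum`, `contDiff_euclidean`,
`measurable_fderiv_apply_const`, `Real.strictAntiOn_rpow_Ioi_of_exponent_neg`.

## References

* T. Tao, *Localisation and compactness properties of the Navier–Stokes global regularity
  problem*, Anal. PDE 6 (2013) 25–107 = arXiv:1108.1165 (`Tao2011`): (8)–(9) pp. 4–5 (the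
  normalised pressure with force), §4 Lemma 4.1 (i) = arXiv Lemma 25 (i), p. 14.
* D. Gilbarg, N. S. Trudinger, *Elliptic Partial Differential Equations of Second Order* (2001),
  (2.12)–(2.13), (2.17), Lemma 4.1, Lemma 4.2 (`GilbargTrudinger2001`).
-/

noncomputable section

open MeasureTheory Set Filter Metric Topology InnerProductSpace Function Real
open scoped RealInnerProductSpace Laplacian ContDiff ENNReal

namespace Literature.Analysis.FluidPDE

namespace ForcePotential

/-! ### The Japanese-bracket weight `⟨z⟩⁻² = (1 + |z|)⁻²` on `ℝ³` -/

/-- The tail weight `w(z) = (1 + |z|)⁻²` (square integrable on `ℝ³`). [folklore] -/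
def jbw (z : EuclideanSpace ℝ (Fin 3)) : ℝ := ((1 + ‖z‖) ^ 2)⁻¹

/-- `w > 0`. [folklore] -/
private theorem jbw_pos (z : EuclideanSpace ℝ (Fin 3)) : 0 < jbw z := by
  unfold jbw; positivity

/-- `w ≤ 1`. [folklore] -/
private theorem jbw_le_one (z : EuclideanSpace ℝ (Fin 3)) : jbw z ≤ 1 := by
  unfold jbw
  rw [inv_le_one_iff₀]
  right
  nlinarith [norm_nonneg z]

/-- `w` is continuous. [folklore] -/
private theorem continuous_jbw : Continuous jbw := by
  unfold jbw
  exact Continuous.inv₀ (by fun_prop) fun z => by positivity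

/-- **Shift comparison**: `w(x - y) ≤ 4 w(x₀ - y)` for `|x - x₀| ≤ 1` (since
`1 + |x₀ - y| ≤ 2 (1 + |x - y|)`). [folklore] -/
private theorem jbw_sub_le {x x₀ : EuclideanSpace ℝ (Fin 3)} (hx : ‖x - x₀‖ ≤ 1)
    (y : EuclideanSpace ℝ (Fin 3)) : jbw (x - y) ≤ 4 * jbw (x₀ - y) := by
  unfold jbw
  have h1 : ‖x₀ - y‖ ≤ ‖x - x₀‖ + ‖x - y‖ := by
    calc ‖x₀ - y‖ = ‖(x - y) - (x - x₀)‖ := by congr 1; abel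
      _ ≤ ‖x - y‖ + ‖x - x₀‖ := norm_sub_le _ _
      _ = ‖x - x₀‖ + ‖x - y‖ := add_comm _ _
  have h2 : 1 + ‖x₀ - y‖ ≤ 2 * (1 + ‖x - y‖) := by linarith [norm_nonneg (x - y)]
  have h3 : 0 < 1 + ‖x₀ - y‖ := by positivity
  have h4 : 0 < 1 + ‖x - y‖ := by positivity
  rw [show (4 : ℝ) * ((1 + ‖x₀ - y‖) ^ 2)⁻¹ = ((1 + ‖x₀ - y‖) ^ 2 / 4)⁻¹ by
    rw [inv_div]; ring]
  apply inv_anti₀ (by positivity)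
  nlinarith [h2, h3, h4]

/-- `w² = (1 + |z|)⁻⁴` is integrable on `ℝ³` (`4 > 3`). [folklore] -/
private theorem integrable_jbw_sq : Integrable (fun z => jbw z ^ 2) (volume : Measure (EuclideanSpace ℝ (Fin 3))) := by
  have h : Integrable (fun y : EuclideanSpace ℝ (Fin 3) => (1 + ‖y‖) ^ (-(4 : ℝ))) volume :=
    integrable_one_add_norm (by rw [finrank_euclideanSpace_fin]; norm_num)
  refine h.congr (Eventually.of_forall fun y => ?_)
  show (1 + ‖y‖) ^ (-(4 : ℝ)) = (((1 + ‖y‖) ^ 2)⁻¹) ^ 2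
  rw [inv_pow, ← pow_mul, Real.rpow_neg (by positivity), show (4 : ℝ) = ((4 : ℕ) : ℝ) by norm_num,
    Real.rpow_natCast]

/-- `w ∈ L²(ℝ³)`. [folklore] -/
private theorem memLp_two_jbw : MemLp jbw 2 (volume : Measure (EuclideanSpace ℝ (Fin 3))) := by
  refine (memLp_two_iff_integrable_sq continuous_jbw.aestronglyMeasurable).2 ?_
  exact integrable_jbw_sq

/-- `w(x₀ - ·) ∈ L²(ℝ³)` (translation and reflection invariance). [folklore] -/
private theorem memLp_two_jbw_sub (x₀ : EuclideanSpace ℝ (Fin 3)) :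
    MemLp (fun y => jbw (x₀ - y)) 2 (volume : Measure (EuclideanSpace ℝ (Fin 3))) := by
  exact memLp_two_jbw.comp_measurePreserving (Measure.measurePreserving_sub_left volume x₀)

/-- **Cauchy–Schwarz**: `∫ w(x₀ - y) |g(y)| dy < ∞` for `g ∈ L²`. [folklore] -/
private theorem integrable_jbw_sub_mul {g : EuclideanSpace ℝ (Fin 3) → ℝ} (hg : MemLp g 2 volume)
    (x₀ : EuclideanSpace ℝ (Fin 3)) :
    Integrable (fun y => jbw (x₀ - y) * ‖g y‖) (volume : Measure (EuclideanSpace ℝ (Fin 3))) :=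
  (memLp_two_jbw_sub x₀).integrable_mul hg.norm

/-! ### Tail kernels: differentiation under the integral sign against `L²` weights

Scalar kernels `K ∈ C²(ℝ³)` with `|K|, ‖DK‖, ‖D²K‖ ≤ M ⟨z⟩⁻²` against weights `g ∈ L²`
(continuous): `x ↦ ∫ K(x - y) g(y) dy` is `C²`, with derivatives under the integral sign. This is
the square-integrable counterpart of the bounded-kernel/`L¹`-weight lemmas of
`PressureRepresentation` and of the `L¹`-kernel/smooth-weight lemmas of `HarmonicProbe`. -/

variable {K g : EuclideanSpace ℝ (Fin 3) → ℝ}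

/-- Integrability of `y ↦ K(x - y) g(y)` for `|K| ≤ M₀ w` and `g ∈ L²` continuous. [cite: GilbargTrudinger2001, Lemma 4.1] -/
theorem integrable_tail_mul (hK : Continuous K) {M₀ : ℝ} (hM₀ : ∀ z, |K z| ≤ M₀ * jbw z)
    (hgc : Continuous g) (hg : MemLp g 2 volume) (x : EuclideanSpace ℝ (Fin 3)) :
    Integrable (fun y => K (x - y) * g y) (volume : Measure (EuclideanSpace ℝ (Fin 3))) := by
  refine Integrable.mono' ((integrable_jbw_sub_mul hg x).const_mul M₀)
    ((hK.comp (continuous_const.sub continuous_id)).mul hgc).aestronglyMeasurable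
    (Eventually.of_forall fun y => ?_)
  rw [norm_mul, Real.norm_eq_abs]
  calc |K (x - y)| * ‖g y‖ ≤ M₀ * jbw (x - y) * ‖g y‖ :=
        mul_le_mul_of_nonneg_right (hM₀ _) (norm_nonneg _)
    _ = M₀ * (jbw (x - y) * ‖g y‖) := by ring

/-- Continuity of `x ↦ ∫ K(x - y) g(y) dy` (dominated convergence with the shifted weight
`4 M₀ w(x₀ - y) |g(y)|` on the unit ball around `x₀`). [cite: GilbargTrudinger2001, Lemma 4.1] -/
theorem continuous_integral_tail_mul (hK : Continuous K) {M₀ : ℝ} (hM₀ : ∀ z, |K z| ≤ M₀ * jbw z)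
    (hgc : Continuous g) (hg : MemLp g 2 volume) :
    Continuous fun x => ∫ y, K (x - y) * g y := by
  have hM : 0 ≤ M₀ := by
    have := hM₀ 0
    exact nonneg_of_mul_nonneg_left ((abs_nonneg _).trans this) (jbw_pos 0)
  refine continuous_iff_continuousAt.2 fun x₀ => ?_
  refine continuousAt_of_dominated (bound := fun y => 4 * M₀ * (jbw (x₀ - y) * ‖g y‖)) ?_ ?_ ?_ ?_
  · exact Eventually.of_forall fun x =>
      ((hK.comp (continuous_const.sub continuous_id)).mul hgc).aestronglyMeasurable
  · filter_upwards [closedBall_mem_nhds x₀ one_pos] with x hx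
    refine Eventually.of_forall fun y => ?_
    rw [mem_closedBall, dist_eq_norm] at hx
    rw [norm_mul, Real.norm_eq_abs]
    calc |K (x - y)| * ‖g y‖ ≤ M₀ * jbw (x - y) * ‖g y‖ :=
          mul_le_mul_of_nonneg_right (hM₀ _) (norm_nonneg _)
      _ ≤ M₀ * (4 * jbw (x₀ - y)) * ‖g y‖ := by
          gcongr
          exact jbw_sub_le hx y
      _ = 4 * M₀ * (jbw (x₀ - y) * ‖g y‖) := by ring
  · exact (integrable_jbw_sub_mul hg x₀).const_mul _
  · exact Eventually.of_forall fun y =>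
      ((hK.comp (continuous_id.sub continuous_const)).mul continuous_const).continuousAt

/-- **Differentiation under the integral sign**: for `K ∈ C¹` with `|K| ≤ M₀ w`, `‖DK‖ ≤ M₁ w`
and `g ∈ L²` continuous, `x ↦ ∫ K(x - y) g(y) dy` has derivative `∫ g(y) DK(x - y) dy`. [cite: GilbargTrudinger2001, Lemma 4.1] -/
theorem hasFDerivAt_integral_tail_mul (hK : ContDiff ℝ 1 K) {M₀ M₁ : ℝ}
    (hM₀ : ∀ z, |K z| ≤ M₀ * jbw z) (hM₁ : ∀ z, ‖fderiv ℝ K z‖ ≤ M₁ * jbw z)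
    (hgc : Continuous g) (hg : MemLp g 2 volume) (x₀ : EuclideanSpace ℝ (Fin 3)) :
    HasFDerivAt (fun x => ∫ y, K (x - y) * g y)
      (∫ y, g y • fderiv ℝ K (x₀ - y)) x₀ := by
  have hKc : Continuous K := hK.continuous
  have hDK : Continuous (fderiv ℝ K) := hK.continuous_fderiv one_ne_zero
  refine hasFDerivAt_integral_of_dominated_of_fderiv_le
    (F' := fun x y => g y • fderiv ℝ K (x - y))
    (bound := fun y => 4 * M₁ * (jbw (x₀ - y) * ‖g y‖)) (closedBall_mem_nhds x₀ one_pos)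
    ?_ ?_ ?_ ?_ ?_ ?_
  · exact Eventually.of_forall fun x =>
      ((hKc.comp (continuous_const.sub continuous_id)).mul hgc).aestronglyMeasurable
  · exact integrable_tail_mul hKc hM₀ hgc hg x₀
  · exact (hgc.smul (hDK.comp (continuous_const.sub continuous_id))).aestronglyMeasurable
  · refine Eventually.of_forall fun y x hx => ?_
    rw [mem_closedBall, dist_eq_norm] at hx
    rw [norm_smul]
    calc ‖g y‖ * ‖fderiv ℝ K (x - y)‖ ≤ ‖g y‖ * (M₁ * jbw (x - y)) :=
          mul_le_mul_of_nonneg_left (hM₁ _) (norm_nonneg _)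
      _ ≤ ‖g y‖ * (M₁ * (4 * jbw (x₀ - y))) := by
          have hM : 0 ≤ M₁ := by
            have := hM₁ 0
            exact nonneg_of_mul_nonneg_left ((norm_nonneg _).trans this) (jbw_pos 0)
          gcongr
          exact jbw_sub_le hx y
      _ = 4 * M₁ * (jbw (x₀ - y) * ‖g y‖) := by ring
  · exact (integrable_jbw_sub_mul hg x₀).const_mul _
  · refine Eventually.of_forall fun y x _ => ?_
    have h1 : HasFDerivAt (fun x : EuclideanSpace ℝ (Fin 3) => K (x - y)) (fderiv ℝ K (x - y)) x := by
      have := ((hK.differentiable one_ne_zero) (x - y)).hasFDerivAt.comp x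
        (hasFDerivAt_sub_const y)
      rwa [ContinuousLinearMap.comp_id] at this
    exact h1.mul_const (g y)

/-- The directional derivative formula `∂ₐ ∫ K(x - y) g(y) dy = ∫ ∂ₐK(x - y) g(y) dy`. [cite: GilbargTrudinger2001, Lemma 4.1] -/
theorem fderiv_integral_tail_mul_apply (hK : ContDiff ℝ 1 K) {M₀ M₁ : ℝ}
    (hM₀ : ∀ z, |K z| ≤ M₀ * jbw z) (hM₁ : ∀ z, ‖fderiv ℝ K z‖ ≤ M₁ * jbw z)
    (hgc : Continuous g) (hg : MemLp g 2 volume) (x a : EuclideanSpace ℝ (Fin 3)) :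
    fderiv ℝ (fun x => ∫ y, K (x - y) * g y) x a = ∫ y, fderiv ℝ K (x - y) a * g y := by
  rw [(hasFDerivAt_integral_tail_mul hK hM₀ hM₁ hgc hg x).fderiv,
    ContinuousLinearMap.integral_apply]
  · refine integral_congr_ae (Eventually.of_forall fun y => ?_)
    show (g y • fderiv ℝ K (x - y)) a = fderiv ℝ K (x - y) a * g y
    rw [_root_.FunLike.coe_smul, Pi.smul_apply, smul_eq_mul, mul_comm]
  · refine Integrable.mono' ((integrable_jbw_sub_mul hg x).const_mul M₁)
      (hgc.smul ((hK.continuous_fderiv one_ne_zero).comp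
        (continuous_const.sub continuous_id))).aestronglyMeasurable
      (Eventually.of_forall fun y => ?_)
    rw [norm_smul]
    calc ‖g y‖ * ‖fderiv ℝ K (x - y)‖ ≤ ‖g y‖ * (M₁ * jbw (x - y)) :=
          mul_le_mul_of_nonneg_left (hM₁ _) (norm_nonneg _)
      _ = M₁ * (jbw (x - y) * ‖g y‖) := by ring

/-- A directional derivative `∂ₐK` of a tail kernel is a tail kernel: `|∂ₐK| ≤ M₁|a| w` and
`‖D(∂ₐK)‖ ≤ M₂|a| w`. [cite: GilbargTrudinger2001, Lemma 4.1] -/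
theorem tail_bounds_fderiv_apply (hK : ContDiff ℝ 2 K) {M₁ M₂ : ℝ}
    (hM₁ : ∀ z, ‖fderiv ℝ K z‖ ≤ M₁ * jbw z) (hM₂ : ∀ z, ‖fderiv ℝ (fderiv ℝ K) z‖ ≤ M₂ * jbw z)
    (a : EuclideanSpace ℝ (Fin 3)) :
    (∀ z, |fderiv ℝ K z a| ≤ M₁ * ‖a‖ * jbw z) ∧
      ∀ z, ‖fderiv ℝ (fun w => fderiv ℝ K w a) z‖ ≤ M₂ * ‖a‖ * jbw z := by
  have hDK : ContDiff ℝ 1 (fderiv ℝ K) := hK.fderiv_right (m := 1) le_rfl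
  refine ⟨fun z => ?_, fun z => ?_⟩
  · rw [← Real.norm_eq_abs]
    calc ‖fderiv ℝ K z a‖ ≤ ‖fderiv ℝ K z‖ * ‖a‖ := ContinuousLinearMap.le_opNorm _ _
      _ ≤ M₁ * jbw z * ‖a‖ := mul_le_mul_of_nonneg_right (hM₁ z) (norm_nonneg _)
      _ = M₁ * ‖a‖ * jbw z := by ring
  · have hd : DifferentiableAt ℝ (fderiv ℝ K) z := (hDK.differentiable one_ne_zero) z
    rw [fderiv_clm_apply hd (differentiableAt_const a)]
    simp only [fderiv_fun_const, Pi.zero_apply, ContinuousLinearMap.comp_zero, zero_add]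
    have hM : 0 ≤ M₂ * ‖a‖ * jbw z := by
      have h0 : 0 ≤ M₂ := by
        have := hM₂ 0
        exact nonneg_of_mul_nonneg_left ((norm_nonneg (fderiv ℝ (fderiv ℝ K) 0)).trans this)
          (jbw_pos 0)
      have := jbw_pos z
      positivity
    refine ContinuousLinearMap.opNorm_le_bound _ hM fun w => ?_
    rw [ContinuousLinearMap.flip_apply]
    calc ‖fderiv ℝ (fderiv ℝ K) z w a‖ ≤ ‖fderiv ℝ (fderiv ℝ K) z w‖ * ‖a‖ :=
          ContinuousLinearMap.le_opNorm _ _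
      _ ≤ ‖fderiv ℝ (fderiv ℝ K) z‖ * ‖w‖ * ‖a‖ := by
          gcongr; exact ContinuousLinearMap.le_opNorm _ _
      _ ≤ M₂ * jbw z * ‖w‖ * ‖a‖ := by gcongr; exact hM₂ z
      _ = M₂ * ‖a‖ * jbw z * ‖w‖ := by ring

/-- **`C²` regularity and the pure second derivatives** of `x ↦ ∫ K(x - y) g(y) dy` for a `C²`
tail kernel (`|K|, ‖DK‖, ‖D²K‖ ≤ M w`) against `g ∈ L²` continuous:
`∂ₐ∂ₐ ∫ K(x - y) g(y) dy = ∫ ∂ₐ∂ₐK(x - y) g(y) dy`. [cite: GilbargTrudinger2001, Lemma 4.1] -/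
theorem contDiff_two_integral_tail_mul (hK : ContDiff ℝ 2 K) {M₀ M₁ M₂ : ℝ}
    (hM₀ : ∀ z, |K z| ≤ M₀ * jbw z) (hM₁ : ∀ z, ‖fderiv ℝ K z‖ ≤ M₁ * jbw z)
    (hM₂ : ∀ z, ‖fderiv ℝ (fderiv ℝ K) z‖ ≤ M₂ * jbw z)
    (hgc : Continuous g) (hg : MemLp g 2 volume) :
    ContDiff ℝ 2 (fun x => ∫ y, K (x - y) * g y) ∧
      ∀ x a, fderiv ℝ (fun x' => fderiv ℝ (fun x => ∫ y, K (x - y) * g y) x' a) x a =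
        ∫ y, fderiv ℝ (fun w => fderiv ℝ K w a) (x - y) a * g y := by
  have hK1 : ContDiff ℝ 1 K := hK.of_le one_le_two
  have hKa : ∀ a, ContDiff ℝ 1 fun z => fderiv ℝ K z a := fun a =>
    (hK.fderiv_right (m := 1) le_rfl).clm_apply contDiff_const
  have hb := fun a => tail_bounds_fderiv_apply hK hM₁ hM₂ a
  -- first derivatives
  have hD1 : ∀ x, HasFDerivAt (fun x => ∫ y, K (x - y) * g y)
      (∫ y, g y • fderiv ℝ K (x - y)) x :=
    fun x => hasFDerivAt_integral_tail_mul hK1 hM₀ hM₁ hgc hg x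
  have hfa : ∀ a, (fun x => fderiv ℝ (fun x => ∫ y, K (x - y) * g y) x a) =
      fun x => ∫ y, (fun z => fderiv ℝ K z a) (x - y) * g y := fun a =>
    funext fun x => fderiv_integral_tail_mul_apply hK1 hM₀ hM₁ hgc hg x a
  -- second derivatives
  have hD2 : ∀ a x, HasFDerivAt (fun x => ∫ y, (fun z => fderiv ℝ K z a) (x - y) * g y)
      (∫ y, g y • fderiv ℝ (fun z => fderiv ℝ K z a) (x - y)) x := fun a x =>
    hasFDerivAt_integral_tail_mul (hKa a) (hb a).1 (hb a).2 hgc hg x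
  -- continuity of the second derivatives: components are again tail integrals
  have hcont2 : ∀ a, Continuous fun x =>
      ∫ y, g y • fderiv ℝ (fun z => fderiv ℝ K z a) (x - y) := by
    intro a
    -- it suffices that `x ↦ L x v` is continuous for every `v` (finite dimension)
    refine continuous_clm_apply.2 fun v => ?_
    have e : (fun x => (∫ y, g y • fderiv ℝ (fun z => fderiv ℝ K z a) (x - y)) v) =
        fun x => ∫ y, fderiv ℝ (fun z => fderiv ℝ K z a) (x - y) v * g y := by
      funext x
      rw [← (hD2 a x).fderiv, fderiv_integral_tail_mul_apply (hKa a) (hb a).1 (hb a).2 hgc hg x v]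
    rw [e]
    -- `∂ᵥ∂ₐK` is a tail kernel (order zero bound from `‖D(∂ₐK)‖ ≤ M₂|a| w`)
    have hKav : Continuous fun z => fderiv ℝ (fun z => fderiv ℝ K z a) z v :=
      ((hKa a).continuous_fderiv one_ne_zero).clm_apply continuous_const
    have hbd : ∀ z, |fderiv ℝ (fun z => fderiv ℝ K z a) z v| ≤ M₂ * ‖a‖ * ‖v‖ * jbw z := by
      intro z
      rw [← Real.norm_eq_abs]
      calc ‖fderiv ℝ (fun z => fderiv ℝ K z a) z v‖
          ≤ ‖fderiv ℝ (fun z => fderiv ℝ K z a) z‖ * ‖v‖ := ContinuousLinearMap.le_opNorm _ _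
        _ ≤ M₂ * ‖a‖ * jbw z * ‖v‖ := mul_le_mul_of_nonneg_right ((hb a).2 z) (norm_nonneg _)
        _ = M₂ * ‖a‖ * ‖v‖ * jbw z := by ring
    exact continuous_integral_tail_mul hKav hbd hgc hg
  refine ⟨?_, fun x a => ?_⟩
  · rw [show (2 : WithTop ℕ∞) = 1 + 1 from rfl, contDiff_succ_iff_fderiv_apply]
    refine ⟨fun x => (hD1 x).differentiableAt, fun h => absurd h (by norm_cast), fun a => ?_⟩
    rw [hfa a, contDiff_one_iff_fderiv]
    refine ⟨fun x => (hD2 a x).differentiableAt, ?_⟩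
    have : fderiv ℝ (fun x => ∫ y, (fun z => fderiv ℝ K z a) (x - y) * g y) =
        fun x => ∫ y, g y • fderiv ℝ (fun z => fderiv ℝ K z a) (x - y) :=
      funext fun x => (hD2 a x).fderiv
    rw [this]
    exact hcont2 a
  · rw [hfa a, fderiv_integral_tail_mul_apply (hKa a) (hb a).1 (hb a).2 hgc hg x a]

/-- **The Laplacian under the integral sign**: `Δ ∫ K(x - y) g(y) dy = ∫ ΔK(x - y) g(y) dy` for a
`C²` tail kernel against `g ∈ L²` continuous. [cite: GilbargTrudinger2001, Lemma 4.1] -/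
theorem laplacian_integral_tail_mul (hK : ContDiff ℝ 2 K) {M₀ M₁ M₂ : ℝ}
    (hM₀ : ∀ z, |K z| ≤ M₀ * jbw z) (hM₁ : ∀ z, ‖fderiv ℝ K z‖ ≤ M₁ * jbw z)
    (hM₂ : ∀ z, ‖fderiv ℝ (fderiv ℝ K) z‖ ≤ M₂ * jbw z)
    (hgc : Continuous g) (hg : MemLp g 2 volume) (x : EuclideanSpace ℝ (Fin 3)) :
    Δ (fun x => ∫ y, K (x - y) * g y) x = ∫ y, (Δ K) (x - y) * g y := by
  set b := EuclideanSpace.basisFun (Fin 3) ℝ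
  obtain ⟨hP, hP2⟩ := contDiff_two_integral_tail_mul hK hM₀ hM₁ hM₂ hgc hg
  rw [laplacian_eq_sum_fderiv_fderiv b hP x]
  have hb := fun a => tail_bounds_fderiv_apply hK hM₁ hM₂ a
  -- each pure second derivative is a tail integral
  have hint : ∀ i, Integrable (fun y => fderiv ℝ (fun w => fderiv ℝ K w (b i))
      (x - y) (b i) * g y) (volume : Measure (EuclideanSpace ℝ (Fin 3))) := by
    intro i
    set a := b i
    have hKa : ContDiff ℝ 1 fun z => fderiv ℝ K z a :=
      (hK.fderiv_right (m := 1) le_rfl).clm_apply contDiff_const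
    have hKav : Continuous fun z => fderiv ℝ (fun z => fderiv ℝ K z a) z a :=
      (hKa.continuous_fderiv one_ne_zero).clm_apply continuous_const
    refine integrable_tail_mul hKav (M₀ := M₂ * ‖a‖ * ‖a‖) (fun z => ?_) hgc hg x
    rw [← Real.norm_eq_abs]
    calc ‖fderiv ℝ (fun z => fderiv ℝ K z a) z a‖
        ≤ ‖fderiv ℝ (fun z => fderiv ℝ K z a) z‖ * ‖a‖ := ContinuousLinearMap.le_opNorm _ _
      _ ≤ M₂ * ‖a‖ * jbw z * ‖a‖ := mul_le_mul_of_nonneg_right ((hb a).2 z) (norm_nonneg _)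
      _ = M₂ * ‖a‖ * ‖a‖ * jbw z := by ring
  have e1 : ∀ i, fderiv ℝ (fun x' => fderiv ℝ (fun x => ∫ y, K (x - y) * g y) x'
      (b i)) x (b i) =
      ∫ y, fderiv ℝ (fun w => fderiv ℝ K w (b i)) (x - y)
        (b i) * g y := fun i => hP2 x _
  simp_rw [e1]
  rw [← integral_finsetSum _ fun i _ => hint i]
  refine integral_congr_ae (Eventually.of_forall fun y => ?_)
  show ∑ i, fderiv ℝ (fun w => fderiv ℝ K w (b i)) (x - y) (b i) * g y = (Δ K) (x - y) * g y
  rw [← Finset.sum_mul, laplacian_eq_sum_fderiv_fderiv b hK (x - y)]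

/-! ### Homogeneous decay and the conversion to tail bounds -/

section Decay

variable {F : Type*} [NormedAddCommGroup F] [NormedSpace ℝ F]

/-- **Quantitative decay of homogeneous functions**: a function on `ℝ³` homogeneous of degree
`m ≤ -2` and continuous off the origin satisfies `‖Φ(z)‖ ≤ C |z|⁻²` for `|z| ≥ 1`. [cite: GilbargTrudinger2001, (2.13)–(2.14)] -/
theorem decay_of_homogeneous (Φ : EuclideanSpace ℝ (Fin 3) → F) (m : ℤ) (hm : m ≤ -2)
    (hΦ : ∀ c : ℝ, 0 < c → ∀ z, Φ (c • z) = c ^ m • Φ z) (hc : ContinuousOn Φ {0}ᶜ) :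
    ∃ C, 0 ≤ C ∧ ∀ z, 1 ≤ ‖z‖ → ‖Φ z‖ ≤ C * (‖z‖ ^ 2)⁻¹ := by
  have hs : sphere (0 : EuclideanSpace ℝ (Fin 3)) 1 ⊆ {0}ᶜ := fun w hw => by
    rw [mem_sphere_zero_iff_norm] at hw
    intro h0
    rw [mem_singleton_iff] at h0
    rw [h0, norm_zero] at hw
    exact one_ne_zero hw.symm
  obtain ⟨M, hM⟩ := (isCompact_sphere (0 : EuclideanSpace ℝ (Fin 3)) 1).exists_bound_of_continuousOn
    (hc.mono hs)
  refine ⟨max M 0, le_max_right _ _, fun z hz => ?_⟩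
  have hz0 : 0 < ‖z‖ := one_pos.trans_le hz
  set w : EuclideanSpace ℝ (Fin 3) := ‖z‖⁻¹ • z with hw
  have hwn : ‖w‖ = 1 := by
    rw [hw, norm_smul, norm_inv, norm_norm, inv_mul_cancel₀ hz0.ne']
  have hzw : z = ‖z‖ • w := by rw [hw, smul_smul, mul_inv_cancel₀ hz0.ne', one_smul]
  have hMw : ‖Φ w‖ ≤ max M 0 := (hM w (mem_sphere_zero_iff_norm.2 hwn)).trans (le_max_left _ _)
  have key : Φ z = ‖z‖ ^ m • Φ w := by
    conv_lhs => rw [hzw]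
    exact hΦ _ hz0 w
  rw [key, norm_smul, norm_zpow, norm_norm]
  have h1 : ‖z‖ ^ m ≤ ‖z‖ ^ (-2 : ℤ) := zpow_le_zpow_right₀ hz hm
  have h2 : ‖z‖ ^ (-2 : ℤ) = (‖z‖ ^ 2)⁻¹ := by
    rw [zpow_neg, zpow_ofNat]
  calc ‖z‖ ^ m * ‖Φ w‖ ≤ ‖z‖ ^ (-2 : ℤ) * max M 0 :=
        mul_le_mul h1 hMw (norm_nonneg _) (by positivity)
    _ = max M 0 * (‖z‖ ^ 2)⁻¹ := by rw [h2, mul_comm]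

omit [NormedSpace ℝ F] in
/-- **From decay and continuity to a tail bound**: `‖Ψ(z)‖ ≤ C|z|⁻²` for `|z| ≥ R ≥ 1` and `Ψ`
continuous give `‖Ψ‖ ≤ M ⟨z⟩⁻²` everywhere. [cite: GilbargTrudinger2001, (2.13)–(2.14)] -/
theorem exists_le_mul_jbw {Ψ : EuclideanSpace ℝ (Fin 3) → F} (hΨ : Continuous Ψ) {R C : ℝ}
    (hR : 1 ≤ R) (hC : 0 ≤ C) (hd : ∀ z, R ≤ ‖z‖ → ‖Ψ z‖ ≤ C * (‖z‖ ^ 2)⁻¹) :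
    ∃ M, ∀ z, ‖Ψ z‖ ≤ M * jbw z := by
  obtain ⟨B, hB⟩ := (isCompact_closedBall (0 : EuclideanSpace ℝ (Fin 3)) R).exists_bound_of_continuousOn
    hΨ.continuousOn
  have hB0 : 0 ≤ B := (norm_nonneg _).trans (hB 0 (mem_closedBall_self (by linarith)))
  refine ⟨max (B * (1 + R) ^ 2) (4 * C), fun z => ?_⟩
  have hj := jbw_pos z
  by_cases hz : ‖z‖ ≤ R
  · have h1 : ‖Ψ z‖ ≤ B := hB z (mem_closedBall_zero_iff.2 hz)
    have h2 : B ≤ B * (1 + R) ^ 2 * jbw z := by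
      unfold jbw
      rw [mul_assoc]
      have : 1 ≤ (1 + R) ^ 2 * ((1 + ‖z‖) ^ 2)⁻¹ := by
        rw [← div_eq_mul_inv, one_le_div (by positivity)]
        nlinarith [norm_nonneg z]
      nlinarith
    calc ‖Ψ z‖ ≤ B * (1 + R) ^ 2 * jbw z := h1.trans h2
      _ ≤ max (B * (1 + R) ^ 2) (4 * C) * jbw z := by gcongr; exact le_max_left _ _
  · rw [not_le] at hz
    have hz1 : 1 ≤ ‖z‖ := hR.trans hz.le
    have h1 := hd z hz.le
    have h2 : (‖z‖ ^ 2)⁻¹ ≤ 4 * jbw z := by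
      unfold jbw
      rw [show (4 : ℝ) * ((1 + ‖z‖) ^ 2)⁻¹ = ((1 + ‖z‖) ^ 2 / 4)⁻¹ by rw [inv_div]; ring]
      apply inv_anti₀ (by positivity)
      nlinarith
    calc ‖Ψ z‖ ≤ C * (‖z‖ ^ 2)⁻¹ := h1
      _ ≤ C * (4 * jbw z) := by gcongr
      _ = 4 * C * jbw z := by ring
      _ ≤ max (B * (1 + R) ^ 2) (4 * C) * jbw z := by gcongr; exact le_max_right _ _

end Decay

/-! ### The gradient kernel `∂ⱼΓ` and the far kernels `∂ⱼΓ∞` -/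

section FarKernel

open NewtonPotentialHolder NewtonPotentialRepresentation

variable {r₀ r₁ : ℝ}

/-- `∂ⱼΓ(z) = zⱼ/(4π|z|³)` is homogeneous of degree `-2`. [cite: GilbargTrudinger2001, (2.13)–(2.14)] -/
theorem newtonKernelGrad_homogeneous (j : Fin 3) (c : ℝ) (hc : 0 < c)
    (z : EuclideanSpace ℝ (Fin 3)) :
    newtonKernelGrad j (c • z) = c ^ (-2 : ℤ) • newtonKernelGrad j z := by
  unfold newtonKernelGrad
  rw [inner_smul_left, norm_smul, Real.norm_eq_abs, abs_of_pos hc, smul_eq_mul, zpow_neg,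
    zpow_ofNat]
  simp only [conj_trivial]
  by_cases hz : z = 0
  · subst hz; simp
  · have hz' : ‖z‖ ≠ 0 := norm_ne_zero_iff.2 hz
    field_simp

/-- `∂ⱼΓ` is smooth off the origin. [cite: GilbargTrudinger2001, (2.13)–(2.14)] -/
theorem contDiffOn_newtonKernelGrad (j : Fin 3) {n : WithTop ℕ∞} :
    ContDiffOn ℝ n (newtonKernelGrad j) ({0}ᶜ : Set (EuclideanSpace ℝ (Fin 3))) := by
  intro z hz
  have hz0 : z ≠ 0 := hz
  unfold newtonKernelGrad
  refine ((contDiffAt_id.inner ℝ contDiffAt_const).div (contDiffAt_const.mul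
    ((contDiffAt_norm ℝ hz0).pow 3)) ?_).contDiffWithinAt
  have : 0 < ‖z‖ := norm_pos_iff.2 hz0
  positivity

/-- Off the closed ball of radius `r₁`, the far kernel `∂ⱼΓ∞` and its first two `fderiv`-iterates
agree with those of `∂ⱼΓ`. [cite: GilbargTrudinger2001, (2.13)–(2.14)] -/
theorem farKernel_iterates_eq (h₀ : 0 ≤ r₀) (h₁ : r₀ < r₁) (j : Fin 3)
    {z : EuclideanSpace ℝ (Fin 3)} (hz : r₁ < ‖z‖) :
    fderiv ℝ (newtonFar r₀ r₁) z (EuclideanSpace.single j (1 : ℝ)) = newtonKernelGrad j z ∧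
    fderiv ℝ (fun w => fderiv ℝ (newtonFar r₀ r₁) w (EuclideanSpace.single j (1 : ℝ))) z =
      fderiv ℝ (newtonKernelGrad j) z ∧
    fderiv ℝ (fderiv ℝ (fun w => fderiv ℝ (newtonFar r₀ r₁) w (EuclideanSpace.single j (1 : ℝ)))) z =
      fderiv ℝ (fderiv ℝ (newtonKernelGrad j)) z := by
  have hr₁ : 0 < r₁ := lt_of_le_of_lt h₀ h₁
  -- near `z`, `Γ∞ = Γ`, hence `∂ⱼΓ∞ = ∂ⱼΓ = newtonKernelGrad j` (the points are nonzero)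
  have e0 := (newtonFar_eventuallyEq_newtonKernel h₀ h₁ hz).fderiv (𝕜 := ℝ)
  have hne : ∀ᶠ w in 𝓝 z, w ≠ (0 : EuclideanSpace ℝ (Fin 3)) := by
    have hz0 : z ≠ 0 := by
      intro h; rw [h, norm_zero] at hz; exact (lt_irrefl _ (hr₁.trans hz)).elim
    exact isOpen_compl_singleton.eventually_mem hz0
  have e1 : (fun w => fderiv ℝ (newtonFar r₀ r₁) w (EuclideanSpace.single j (1 : ℝ))) =ᶠ[𝓝 z]
      newtonKernelGrad j := by
    filter_upwards [e0, hne] with w hw hw0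
    rw [hw, ← newtonKernelGrad_eq_fderiv hw0]
  have e2 := e1.fderiv (𝕜 := ℝ)
  have e3 := e2.fderiv (𝕜 := ℝ)
  exact ⟨e1.eq_of_nhds, e2.eq_of_nhds, e3.eq_of_nhds⟩

/-- **The far kernels `Kⱼ = ∂ⱼΓ∞` are `C²` tail kernels**: smooth, with
`|Kⱼ|, ‖DKⱼ‖, ‖D²Kⱼ‖ ≤ M ⟨z⟩⁻²` (boundedness on a ball; homogeneity of degrees `-2, -3, -4` of
`∂ⱼΓ, D∂ⱼΓ, D²∂ⱼΓ` off it). [cite: GilbargTrudinger2001, (2.13)–(2.14)] -/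
theorem farKernel_tail (h₀ : 0 < r₀) (h₁ : r₀ < r₁) (j : Fin 3) :
    ContDiff ℝ 2 (fun w => fderiv ℝ (newtonFar r₀ r₁) w (EuclideanSpace.single j (1 : ℝ))) ∧
    (∃ M₀, ∀ z, |fderiv ℝ (newtonFar r₀ r₁) z (EuclideanSpace.single j (1 : ℝ))| ≤ M₀ * jbw z) ∧
    (∃ M₁, ∀ z, ‖fderiv ℝ (fun w => fderiv ℝ (newtonFar r₀ r₁) w (EuclideanSpace.single j (1 : ℝ))) z‖
      ≤ M₁ * jbw z) ∧
    (∃ M₂, ∀ z, ‖fderiv ℝ (fderiv ℝ (fun w => fderiv ℝ (newtonFar r₀ r₁) w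
      (EuclideanSpace.single j (1 : ℝ)))) z‖ ≤ M₂ * jbw z) := by
  set K : EuclideanSpace ℝ (Fin 3) → ℝ :=
    fun w => fderiv ℝ (newtonFar r₀ r₁) w (EuclideanSpace.single j (1 : ℝ)) with hKdef
  have hKs : ContDiff ℝ ∞ K :=
    ((contDiff_newtonFar h₀ h₁ (n := ⊤)).fderiv_right (m := ∞) le_rfl).clm_apply contDiff_const
  have hK2 : ContDiff ℝ 2 K := hKs.of_le (by norm_cast)
  -- the model kernel `G = ∂ⱼΓ` and its iterates: homogeneous, continuous off the origin
  set G := newtonKernelGrad j with hGdef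
  have hG : ∀ c : ℝ, 0 < c → ∀ z, G (c • z) = c ^ (-2 : ℤ) • G z := newtonKernelGrad_homogeneous j
  have hDG : ∀ c : ℝ, 0 < c → ∀ z, fderiv ℝ G (c • z) = c ^ (-2 - 1 : ℤ) • fderiv ℝ G z :=
    fderiv_homogeneous G (-2) hG
  have hD2G : ∀ c : ℝ, 0 < c → ∀ z,
      fderiv ℝ (fderiv ℝ G) (c • z) = c ^ (-2 - 1 - 1 : ℤ) • fderiv ℝ (fderiv ℝ G) z :=
    fderiv_homogeneous (fderiv ℝ G) (-2 - 1) hDG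
  have hGs : ContDiffOn ℝ ⊤ G {0}ᶜ := contDiffOn_newtonKernelGrad j
  have hGc : ContinuousOn G {0}ᶜ := hGs.continuousOn
  have hDGs : ContDiffOn ℝ ⊤ (fderiv ℝ G) {0}ᶜ :=
    hGs.fderiv_of_isOpen isOpen_compl_singleton le_rfl
  have hDGc : ContinuousOn (fderiv ℝ G) {0}ᶜ := hDGs.continuousOn
  have hD2Gs : ContDiffOn ℝ ⊤ (fderiv ℝ (fderiv ℝ G)) {0}ᶜ :=
    hDGs.fderiv_of_isOpen isOpen_compl_singleton le_rfl
  have hD2Gc : ContinuousOn (fderiv ℝ (fderiv ℝ G)) {0}ᶜ := hD2Gs.continuousOn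
  obtain ⟨C₀, hC₀, hd₀⟩ := decay_of_homogeneous G (-2) le_rfl hG hGc
  obtain ⟨C₁, hC₁, hd₁⟩ := decay_of_homogeneous (fderiv ℝ G) (-2 - 1) (by norm_num) hDG hDGc
  obtain ⟨C₂, hC₂, hd₂⟩ := decay_of_homogeneous (fderiv ℝ (fderiv ℝ G)) (-2 - 1 - 1) (by norm_num)
    hD2G hD2Gc
  -- transfer to `K` off the ball of radius `R = max (r₁ + 1) 1`
  set R : ℝ := max (r₁ + 1) 1 with hR
  have hR1 : 1 ≤ R := le_max_right _ _
  have hfar : ∀ z : EuclideanSpace ℝ (Fin 3), R ≤ ‖z‖ → r₁ < ‖z‖ ∧ 1 ≤ ‖z‖ := fun z hz =>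
    ⟨by linarith [le_max_left (r₁ + 1) 1], hR1.trans hz⟩
  refine ⟨hK2, ?_, ?_, ?_⟩
  · obtain ⟨M, hM⟩ := exists_le_mul_jbw hKs.continuous hR1 hC₀ fun z hz => by
      obtain ⟨hzr, hz1⟩ := hfar z hz
      simp only [hKdef]
      rw [(farKernel_iterates_eq h₀.le h₁ j hzr).1]
      exact hd₀ z hz1
    exact ⟨M, fun z => by rw [← Real.norm_eq_abs]; exact hM z⟩
  · exact exists_le_mul_jbw (hKs.continuous_fderiv (by norm_cast)) hR1 hC₁ fun z hz => by
      obtain ⟨hzr, hz1⟩ := hfar z hz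
      simp only [hKdef]
      rw [(farKernel_iterates_eq h₀.le h₁ j hzr).2.1]
      exact hd₁ z hz1
  · exact exists_le_mul_jbw ((hKs.fderiv_right (m := ∞) le_rfl).continuous_fderiv (by norm_cast))
      hR1 hC₂ fun z hz => by
      obtain ⟨hzr, hz1⟩ := hfar z hz
      simp only [hKdef]
      rw [(farKernel_iterates_eq h₀.le h₁ j hzr).2.2]
      exact hd₂ z hz1

end FarKernel

/-! ### The far part of the force potential -/

section FarPart

variable {r₀ r₁ : ℝ} {f : EuclideanSpace ℝ (Fin 3) → EuclideanSpace ℝ (Fin 3)}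

/-- **The far part** `Φ∞[f](x) = ∫ DΓ∞(x - y)(f y) dy = Σⱼ ∫ ∂ⱼΓ∞(x - y) fⱼ(y) dy` of the force
potential (cutoff radii `r₀ < r₁`). [folklore] -/
def farPart (r₀ r₁ : ℝ) (f : EuclideanSpace ℝ (Fin 3) → EuclideanSpace ℝ (Fin 3))
    (x : EuclideanSpace ℝ (Fin 3)) : ℝ :=
  ∑ j, ∫ y, fderiv ℝ (newtonFar r₀ r₁) (x - y) (EuclideanSpace.single j (1 : ℝ)) * f y j

/-- The coordinates of a continuous square-integrable field are continuous and square
integrable. [folklore] -/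
private theorem coord_continuous_memLp (hf : Continuous f) (hf2 : MemLp f 2 volume) (j : Fin 3) :
    Continuous (fun y => f y j) ∧ MemLp (fun y => f y j) 2 (volume : Measure (EuclideanSpace ℝ (Fin 3))) := by
  have hc : Continuous fun y => f y j := (EuclideanSpace.proj j).continuous.comp hf
  refine ⟨hc, hf2.of_le hc.aestronglyMeasurable (Eventually.of_forall fun y => ?_)⟩
  exact PiLp.norm_apply_le (f y) j

/-- **`Φ∞[f] ∈ C²`** for `f` continuous and square integrable. [cite: GilbargTrudinger2001, Lemma 4.2] -/
theorem contDiff_farPart (h₀ : 0 < r₀) (h₁ : r₀ < r₁) (hf : Continuous f) (hf2 : MemLp f 2 volume) :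
    ContDiff ℝ 2 (farPart r₀ r₁ f) := by
  unfold farPart
  refine ContDiff.sum fun j _ => ?_
  obtain ⟨hK, ⟨M₀, hM₀⟩, ⟨M₁, hM₁⟩, ⟨M₂, hM₂⟩⟩ := farKernel_tail h₀ h₁ j
  obtain ⟨hgc, hg⟩ := coord_continuous_memLp hf hf2 j
  exact (contDiff_two_integral_tail_mul hK hM₀ hM₁ hM₂ hgc hg).1

/-- The Laplacian of a finite sum of `C²` functions. [folklore] -/
private theorem laplacian_finset_sum {ι : Type*} (s : Finset ι)
    {F : ι → EuclideanSpace ℝ (Fin 3) → ℝ} (hF : ∀ i ∈ s, ContDiff ℝ 2 (F i))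
    (x : EuclideanSpace ℝ (Fin 3)) :
    Δ (fun x => ∑ i ∈ s, F i x) x = ∑ i ∈ s, Δ (F i) x := by
  rw [laplacian_eq_iteratedFDeriv_orthonormalBasis _ (EuclideanSpace.basisFun (Fin 3) ℝ),
    iteratedFDeriv_sum (fun i hi => hF i hi)]
  simp only [Finset.sum_apply, _root_.sum_apply]
  rw [Finset.sum_comm]
  refine Finset.sum_congr rfl fun i _ => ?_
  rw [laplacian_eq_iteratedFDeriv_orthonormalBasis _ (EuclideanSpace.basisFun (Fin 3) ℝ)]

/-- **`ΔΦ∞[f] = ∫ Dλ(x - y)(f y) dy`**, `λ = ΔΓ∞`: the Laplacian falls on the smooth kernel and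
commutes with the directional derivative (`Δ∂ⱼΓ∞ = ∂ⱼΔΓ∞ = ∂ⱼλ`). [cite: GilbargTrudinger2001, Lemma 4.2] -/
theorem laplacian_farPart (h₀ : 0 < r₀) (h₁ : r₀ < r₁) (hf : Continuous f) (hf2 : MemLp f 2 volume)
    (x : EuclideanSpace ℝ (Fin 3)) :
    Δ (farPart r₀ r₁ f) x =
      ∑ j, ∫ y, fderiv ℝ (newtonFarLaplacian r₀ r₁) (x - y) (EuclideanSpace.single j (1 : ℝ)) * f y j := by
  have hΓ3 : ContDiff ℝ 3 (newtonFar r₀ r₁) := contDiff_newtonFar h₀ h₁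
  unfold farPart
  rw [laplacian_finset_sum _ (fun j _ => ?_)]
  · refine Finset.sum_congr rfl fun j _ => ?_
    obtain ⟨hK, ⟨M₀, hM₀⟩, ⟨M₁, hM₁⟩, ⟨M₂, hM₂⟩⟩ := farKernel_tail h₀ h₁ j
    obtain ⟨hgc, hg⟩ := coord_continuous_memLp hf hf2 j
    rw [laplacian_integral_tail_mul hK hM₀ hM₁ hM₂ hgc hg x]
    refine integral_congr_ae (Eventually.of_forall fun y => ?_)
    show (Δ fun w => fderiv ℝ (newtonFar r₀ r₁) w (EuclideanSpace.single j (1 : ℝ))) (x - y) * f y j = _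
    rw [← fderiv_laplacian_apply hΓ3]
    rfl
  · obtain ⟨hK, ⟨M₀, hM₀⟩, ⟨M₁, hM₁⟩, ⟨M₂, hM₂⟩⟩ := farKernel_tail h₀ h₁ j
    obtain ⟨hgc, hg⟩ := coord_continuous_memLp hf hf2 j
    exact (contDiff_two_integral_tail_mul hK hM₀ hM₁ hM₂ hgc hg).1

end FarPart

/-! ### Integrals of integrable kernels vanishing off a ball against continuous functions -/

section BallKernel

/-- `z ↦ k(z) ψ(z)` is integrable for `k ∈ L¹` vanishing off a ball and `ψ` continuous. [folklore] -/
private theorem integrable_mul_of_vanishing {k ψ : EuclideanSpace ℝ (Fin 3) → ℝ} (hk : Integrable k)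
    {ρ : ℝ} (hkρ : ∀ z, ρ < ‖z‖ → k z = 0) (hψ : Continuous ψ) :
    Integrable (fun z => k z * ψ z) (volume : Measure (EuclideanSpace ℝ (Fin 3))) := by
  obtain ⟨C, hC⟩ := (isCompact_closedBall (0 : EuclideanSpace ℝ (Fin 3)) ρ).exists_bound_of_continuousOn
    hψ.continuousOn
  refine Integrable.mono' (hk.norm.mul_const (max C 0)) (hk.aestronglyMeasurable.mul hψ.aestronglyMeasurable)
    (Eventually.of_forall fun z => ?_)
  rw [norm_mul]
  by_cases hz : ‖z‖ ≤ ρ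
  · exact mul_le_mul_of_nonneg_left ((hC z (mem_closedBall_zero_iff.2 hz)).trans (le_max_left _ _))
      (norm_nonneg _)
  · rw [hkρ z (not_le.1 hz), norm_zero, zero_mul]
    positivity

end BallKernel

/-! ### The near kernels `∂ⱼΓ₀` -/

section NearKernel

open NewtonPotentialHolder

variable {r₀ r₁ : ℝ}

/-- `DΓ₀ = 0` off the closed ball of radius `r₁` (`Γ₀` vanishes identically there). [cite: GilbargTrudinger2001, (2.13)–(2.14)] -/
theorem fderiv_newtonNear_eq_zero (h₀ : 0 ≤ r₀) (h₁ : r₀ < r₁) {z : EuclideanSpace ℝ (Fin 3)}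
    (hz : r₁ < ‖z‖) : fderiv ℝ (newtonNear r₀ r₁) z = 0 := by
  have hev : newtonNear r₀ r₁ =ᶠ[𝓝 z] fun _ => (0 : ℝ) := by
    filter_upwards [(isOpen_lt continuous_const continuous_norm).mem_nhds hz] with w hw
    exact newtonNear_eq_zero h₀ h₁ hw.le
  rw [hev.fderiv_eq, fderiv_const_apply]

/-- Off the origin, `DΓ₀ = DΓ - DΓ∞`. [cite: GilbargTrudinger2001, (2.13)–(2.14)] -/
theorem fderiv_newtonNear_eq_sub (h₀ : 0 < r₀) (h₁ : r₀ < r₁) {z : EuclideanSpace ℝ (Fin 3)}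
    (hz : z ≠ 0) :
    fderiv ℝ (newtonNear r₀ r₁) z = fderiv ℝ newtonKernel z - fderiv ℝ (newtonFar r₀ r₁) z := by
  rw [newtonNear_eq_sub]
  exact fderiv_sub ((contDiffAt_newtonKernel hz (n := 1)).differentiableAt (by simp))
    (((contDiff_newtonFar h₀ h₁ (n := 1)).differentiable (by simp)) z)

/-- **Pointwise bound** `‖DΓ₀(z)‖ ≤ (4π|z|²)⁻¹ + C_θ (4π|z|)⁻¹` off the origin
(`Γ₀ = θΓ`, product rule). [cite: GilbargTrudinger2001, (2.13)–(2.14)] -/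
theorem norm_fderiv_newtonNear_le {Cθ : ℝ}
    (hCθ : ∀ w : EuclideanSpace ℝ (Fin 3), ‖fderiv ℝ (radialCutoff r₀ r₁ : EuclideanSpace ℝ (Fin 3) → ℝ) w‖ ≤ Cθ)
    {z : EuclideanSpace ℝ (Fin 3)} (hz : z ≠ 0) :
    ‖fderiv ℝ (newtonNear r₀ r₁) z‖ ≤ (4 * π * ‖z‖ ^ 2)⁻¹ + Cθ * (4 * π * ‖z‖)⁻¹ := by
  have hθ : DifferentiableAt ℝ (radialCutoff r₀ r₁ : EuclideanSpace ℝ (Fin 3) → ℝ) z :=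
    ((radialCutoff_contDiff r₀ r₁ (n := 1)).differentiable (by simp)) z
  have hΓ : DifferentiableAt ℝ newtonKernel z :=
    (contDiffAt_newtonKernel hz (n := 1)).differentiableAt (by simp)
  have e : newtonNear r₀ r₁ = fun w => radialCutoff r₀ r₁ w * newtonKernel w := by
    funext w; rfl
  rw [e, fderiv_fun_mul hθ hΓ]
  have h1 : ‖radialCutoff r₀ r₁ z • fderiv ℝ newtonKernel z‖ ≤ (4 * π * ‖z‖ ^ 2)⁻¹ := by
    rw [norm_smul, norm_fderiv_newtonKernel hz, Real.norm_eq_abs]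
    calc |radialCutoff r₀ r₁ z| * (4 * π * ‖z‖ ^ 2)⁻¹ ≤ 1 * (4 * π * ‖z‖ ^ 2)⁻¹ :=
          mul_le_mul_of_nonneg_right (abs_radialCutoff_le_one r₀ r₁ z) (by positivity)
      _ = (4 * π * ‖z‖ ^ 2)⁻¹ := one_mul _
  have h2 : ‖newtonKernel z • fderiv ℝ (radialCutoff r₀ r₁ : EuclideanSpace ℝ (Fin 3) → ℝ) z‖ ≤
      Cθ * (4 * π * ‖z‖)⁻¹ := by
    rw [norm_smul, Real.norm_eq_abs, abs_newtonKernel, mul_comm]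
    exact mul_le_mul_of_nonneg_right (hCθ z) (by positivity)
  exact (norm_add_le _ _).trans (add_le_add h1 h2)

/-- **`∂ₐΓ₀ ∈ L¹(ℝ³)`**: the directional derivatives of the near kernel are integrable
(`|DΓ₀| ≲ |z|⁻² + |z|⁻¹` on the ball, `0` outside). [cite: GilbargTrudinger2001, (2.13)–(2.14)] -/
theorem integrable_fderiv_newtonNear_apply (h₀ : 0 < r₀) (h₁ : r₀ < r₁) (a : EuclideanSpace ℝ (Fin 3)) :
    Integrable (fun z => fderiv ℝ (newtonNear r₀ r₁) z a) (volume : Measure (EuclideanSpace ℝ (Fin 3))) := by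
  obtain ⟨Cθ, hCθ⟩ := ((radialCutoff_contDiff r₀ r₁ (E' := EuclideanSpace ℝ (Fin 3)) (n := 1)).continuous_fderiv
    (by simp)).bounded_above_of_compact_support ((hasCompactSupport_radialCutoff h₀.le h₁).fderiv (𝕜 := ℝ))
  have hC0 : 0 ≤ Cθ := (norm_nonneg _).trans (hCθ 0)
  -- the majorant
  set B : EuclideanSpace ℝ (Fin 3) → ℝ := (ball (0 : EuclideanSpace ℝ (Fin 3)) (r₁ + 1)).indicator
    fun z => ‖a‖ * ((4 * π)⁻¹ * ‖z‖ ^ (-(2 : ℝ)) + Cθ * (4 * π)⁻¹ * ‖z‖ ^ (-(1 : ℝ))) with hB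
  have hBi : Integrable B (volume : Measure (EuclideanSpace ℝ (Fin 3))) := by
    rw [hB]
    have hI : IntegrableOn (fun z : EuclideanSpace ℝ (Fin 3) =>
        ‖a‖ * ((4 * π)⁻¹ * ‖z‖ ^ (-(2 : ℝ)) + Cθ * (4 * π)⁻¹ * ‖z‖ ^ (-(1 : ℝ))))
        (ball (0 : EuclideanSpace ℝ (Fin 3)) (r₁ + 1)) volume :=
      Integrable.const_mul (Integrable.add
        (Integrable.const_mul (integrableOn_ball_norm_rpow_neg (by norm_num) _) _)
        (Integrable.const_mul (integrableOn_ball_norm_rpow_neg (by norm_num) _) _)) _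
    exact hI.integrable_indicator measurableSet_ball
  have hae : ∀ᵐ z ∂(volume : Measure (EuclideanSpace ℝ (Fin 3))), z ≠ 0 := by
    simp [ae_iff, measure_singleton]
  refine Integrable.mono' hBi (measurable_fderiv_apply_const ℝ (newtonNear r₀ r₁) a).aestronglyMeasurable ?_
  filter_upwards [hae] with z hz
  have hz' : 0 < ‖z‖ := norm_pos_iff.2 hz
  by_cases hzr : r₁ < ‖z‖
  · rw [fderiv_newtonNear_eq_zero h₀.le h₁ hzr]
    simp only [_root_.zero_apply, norm_zero]
    rw [hB]
    by_cases hmem : z ∈ ball (0 : EuclideanSpace ℝ (Fin 3)) (r₁ + 1)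
    · rw [indicator_of_mem hmem]; positivity
    · rw [indicator_of_notMem hmem]
  · have hmem : z ∈ ball (0 : EuclideanSpace ℝ (Fin 3)) (r₁ + 1) := by
      rw [mem_ball_zero_iff]; linarith [not_lt.1 hzr]
    rw [hB, indicator_of_mem hmem]
    calc ‖fderiv ℝ (newtonNear r₀ r₁) z a‖ ≤ ‖fderiv ℝ (newtonNear r₀ r₁) z‖ * ‖a‖ :=
          ContinuousLinearMap.le_opNorm _ _
      _ ≤ ((4 * π * ‖z‖ ^ 2)⁻¹ + Cθ * (4 * π * ‖z‖)⁻¹) * ‖a‖ :=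
          mul_le_mul_of_nonneg_right (norm_fderiv_newtonNear_le hCθ hz) (norm_nonneg _)
      _ = ‖a‖ * ((4 * π)⁻¹ * ‖z‖ ^ (-(2 : ℝ)) + Cθ * (4 * π)⁻¹ * ‖z‖ ^ (-(1 : ℝ))) := by
          rw [Real.rpow_neg hz'.le, Real.rpow_neg hz'.le, show (2 : ℝ) = ((2 : ℕ) : ℝ) by norm_num,
            Real.rpow_natCast, Real.rpow_one, mul_inv, mul_inv]
          ring

/-- **Integration by parts against `Γ₀`**: `∫ ∂ₐΓ₀ ψ = -∫ Γ₀ ∂ₐψ` for `ψ ∈ C¹(ℝ³)` (no support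
condition on `ψ`: `Γ₀` has compact support; the singularity is handled by the tree's
distributional identity `∫ Γ ∂ₐΦ = ∫ ∂ₐΓ Φ` for `Φ ∈ C¹_c` and the smooth part `Γ∞`).
[cite: GilbargTrudinger2001, Lemma 4.1] -/
theorem integral_fderiv_newtonNear_mul (h₀ : 0 < r₀) (h₁ : r₀ < r₁) {ψ : EuclideanSpace ℝ (Fin 3) → ℝ}
    (hψ : ContDiff ℝ 1 ψ) (a : EuclideanSpace ℝ (Fin 3)) :
    ∫ z, fderiv ℝ (newtonNear r₀ r₁) z a * ψ z = -∫ z, newtonNear r₀ r₁ z * fderiv ℝ ψ z a := by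
  have hr₁ : 0 < r₁ := h₀.trans h₁
  -- cutoff `χ = 1` on `B̄(0, r₁ + 1)`, `Ψ = χψ ∈ C¹_c`
  set χ : EuclideanSpace ℝ (Fin 3) → ℝ := radialCutoff (r₁ + 1) (r₁ + 2) with hχ
  have hχs : ContDiff ℝ 1 χ := radialCutoff_contDiff _ _
  have hχc : HasCompactSupport χ := hasCompactSupport_radialCutoff (by linarith) (by linarith)
  set Ψ : EuclideanSpace ℝ (Fin 3) → ℝ := fun z => χ z * ψ z with hΨ
  have hΨs : ContDiff ℝ 1 Ψ := hχs.mul hψ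
  have hΨc : HasCompactSupport Ψ := hχc.mul_right
  have hχ1 : ∀ z : EuclideanSpace ℝ (Fin 3), ‖z‖ ≤ r₁ + 1 → χ z = 1 := fun z hz =>
    radialCutoff_eq_one (by linarith) (by linarith) hz
  -- (1) `Γ₀ ∂ₐψ = Γ₀ ∂ₐΨ` pointwise
  have h1 : ∀ z, newtonNear r₀ r₁ z * fderiv ℝ ψ z a = newtonNear r₀ r₁ z * fderiv ℝ Ψ z a := by
    intro z
    by_cases hz : r₁ ≤ ‖z‖
    · rw [newtonNear_eq_zero h₀.le h₁ hz, zero_mul, zero_mul]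
    · have hlt : ‖z‖ < r₁ + 1 := by linarith [not_le.1 hz]
      have hev : Ψ =ᶠ[𝓝 z] ψ := by
        filter_upwards [radialCutoff_eventuallyEq_one (E := EuclideanSpace ℝ (Fin 3))
          (by linarith : (0 : ℝ) ≤ r₁ + 1) (by linarith : r₁ + 1 < r₁ + 2) hlt] with w hw
        show χ w * ψ w = ψ w
        rw [show χ w = 1 from hw, one_mul]
      rw [hev.fderiv_eq]
  -- (2) `∂ₐΓ₀ ψ = ∂ₐΓ₀ Ψ` pointwise
  have h2 : ∀ z, fderiv ℝ (newtonNear r₀ r₁) z a * ψ z = fderiv ℝ (newtonNear r₀ r₁) z a * Ψ z := by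
    intro z
    by_cases hz : r₁ < ‖z‖
    · rw [fderiv_newtonNear_eq_zero h₀.le h₁ hz]; simp
    · rw [show Ψ z = χ z * ψ z from rfl, hχ1 z (by linarith [not_lt.1 hz]), one_mul]
  -- (3) the distributional identity for `Γ` against `Ψ`: `∫ Γ ∂ₐΨ = -∫ ∂ₐΓ Ψ`
  have h3 : ∫ z, newtonKernel z * fderiv ℝ Ψ z a = -∫ z, fderiv ℝ newtonKernel z a * Ψ z := by
    have key := integral_newtonKernel_smul_fderiv_eq (F := ℝ) hΨs hΨc 0 a
    simp only [zero_sub, smul_eq_mul] at key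
    have eΓ : ∀ z : EuclideanSpace ℝ (Fin 3), newtonKernel (-z) = newtonKernel z := fun z => by
      simp [newtonKernel, norm_neg]
    have eD : ∀ z : EuclideanSpace ℝ (Fin 3), fderiv ℝ newtonKernel (-z) a = -fderiv ℝ newtonKernel z a := by
      intro z
      by_cases hz : z = 0
      · subst hz; simp [fderiv_newtonKernel_zero]
      · rw [fderiv_newtonKernel_apply (neg_ne_zero.2 hz), fderiv_newtonKernel_apply hz, inner_neg_left,
          norm_neg, neg_div]
    simp_rw [eΓ, eD] at key
    rw [key, ← integral_neg]
    refine integral_congr_ae (Eventually.of_forall fun z => ?_)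
    ring
  -- (4) the smooth part: `∫ Γ∞ ∂ₐΨ = -∫ ∂ₐΓ∞ Ψ`
  have hΓfar : ContDiff ℝ 1 (newtonFar r₀ r₁) := contDiff_newtonFar h₀ h₁
  have h4 : ∫ z, newtonFar r₀ r₁ z * fderiv ℝ Ψ z a = -∫ z, fderiv ℝ (newtonFar r₀ r₁) z a * Ψ z := by
    have hP : ContDiff ℝ 1 fun z => newtonFar r₀ r₁ z * Ψ z := hΓfar.mul hΨs
    have hPc : HasCompactSupport fun z => newtonFar r₀ r₁ z * Ψ z := hΨc.mul_left
    have h0 := FluidPDE.integral_fderiv_apply_eq_zero hP hPc a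
    have hpt : ∀ z, fderiv ℝ (fun z => newtonFar r₀ r₁ z * Ψ z) z a =
        fderiv ℝ (newtonFar r₀ r₁) z a * Ψ z + newtonFar r₀ r₁ z * fderiv ℝ Ψ z a := fun z => by
      rw [fderiv_fun_mul ((hΓfar.differentiable one_ne_zero) z) ((hΨs.differentiable one_ne_zero) z)]
      simp only [_root_.add_apply, _root_.FunLike.coe_smul, Pi.smul_apply,
        smul_eq_mul]
      ring
    simp_rw [hpt] at h0
    have i1 : Integrable (fun z => fderiv ℝ (newtonFar r₀ r₁) z a * Ψ z)
        (volume : Measure (EuclideanSpace ℝ (Fin 3))) :=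
      (((hΓfar.continuous_fderiv one_ne_zero).clm_apply continuous_const).mul hΨs.continuous)
        |>.integrable_of_hasCompactSupport hΨc.mul_left
    have i2 : Integrable (fun z => newtonFar r₀ r₁ z * fderiv ℝ Ψ z a)
        (volume : Measure (EuclideanSpace ℝ (Fin 3))) :=
      (hΓfar.continuous.mul ((hΨs.continuous_fderiv one_ne_zero).clm_apply continuous_const))
        |>.integrable_of_hasCompactSupport (hΨc.fderiv_apply (𝕜 := ℝ) a).mul_left
    rw [integral_add i1 i2] at h0
    linarith
  -- (5) assemble: `Γ₀ = Γ - Γ∞`, `∂ₐΓ₀ = ∂ₐΓ - ∂ₐΓ∞` off the origin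
  have iΓΨ : Integrable (fun z => newtonKernel z * fderiv ℝ Ψ z a) (volume : Measure (EuclideanSpace ℝ (Fin 3))) := by
    have := integrable_newtonKernel_mul ((hΨs.continuous_fderiv one_ne_zero).clm_apply continuous_const)
      (hΨc.fderiv_apply (𝕜 := ℝ) a) 0
    simpa [newtonKernel, norm_neg] using this
  have iΓfarΨ : Integrable (fun z => newtonFar r₀ r₁ z * fderiv ℝ Ψ z a)
      (volume : Measure (EuclideanSpace ℝ (Fin 3))) :=
    (hΓfar.continuous.mul ((hΨs.continuous_fderiv one_ne_zero).clm_apply continuous_const))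
      |>.integrable_of_hasCompactSupport (hΨc.fderiv_apply (𝕜 := ℝ) a).mul_left
  have iDΓ₀Ψ : Integrable (fun z => fderiv ℝ (newtonNear r₀ r₁) z a * Ψ z)
      (volume : Measure (EuclideanSpace ℝ (Fin 3))) :=
    integrable_mul_of_vanishing (integrable_fderiv_newtonNear_apply h₀ h₁ a)
      (fun z hz => by rw [fderiv_newtonNear_eq_zero h₀.le h₁ hz]; rfl) hΨs.continuous
  have iDΓfarΨ : Integrable (fun z => fderiv ℝ (newtonFar r₀ r₁) z a * Ψ z)
      (volume : Measure (EuclideanSpace ℝ (Fin 3))) :=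
    (((hΓfar.continuous_fderiv one_ne_zero).clm_apply continuous_const).mul hΨs.continuous)
      |>.integrable_of_hasCompactSupport hΨc.mul_left
  have hae : ∀ᵐ z ∂(volume : Measure (EuclideanSpace ℝ (Fin 3))), z ≠ 0 := by
    simp [ae_iff, measure_singleton]
  calc ∫ z, fderiv ℝ (newtonNear r₀ r₁) z a * ψ z
      = ∫ z, fderiv ℝ (newtonNear r₀ r₁) z a * Ψ z := integral_congr_ae (Eventually.of_forall h2)
    _ = ∫ z, (fderiv ℝ newtonKernel z a * Ψ z - fderiv ℝ (newtonFar r₀ r₁) z a * Ψ z) := by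
        refine integral_congr_ae ?_
        filter_upwards [hae] with z hz
        rw [fderiv_newtonNear_eq_sub h₀ h₁ hz, _root_.sub_apply, sub_mul]
    _ = (∫ z, fderiv ℝ newtonKernel z a * Ψ z) - ∫ z, fderiv ℝ (newtonFar r₀ r₁) z a * Ψ z := by
        refine integral_sub ?_ iDΓfarΨ
        -- `∂ₐΓ Ψ = ∂ₐΓ₀ Ψ + ∂ₐΓ∞ Ψ` a.e., both integrable
        refine (iDΓ₀Ψ.add iDΓfarΨ).congr ?_
        filter_upwards [hae] with z hz
        rw [Pi.add_apply, fderiv_newtonNear_eq_sub h₀ h₁ hz, _root_.sub_apply]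
        ring
    _ = -(∫ z, newtonKernel z * fderiv ℝ Ψ z a) + ∫ z, newtonFar r₀ r₁ z * fderiv ℝ Ψ z a := by
        rw [h3, h4]; ring
    _ = -∫ z, (newtonKernel z * fderiv ℝ Ψ z a - newtonFar r₀ r₁ z * fderiv ℝ Ψ z a) := by
        rw [integral_sub iΓΨ iΓfarΨ]; ring
    _ = -∫ z, newtonNear r₀ r₁ z * fderiv ℝ Ψ z a := by
        congr 1
        refine integral_congr_ae (Eventually.of_forall fun z => ?_)
        rw [newtonNear_eq_sub]; ring
    _ = -∫ z, newtonNear r₀ r₁ z * fderiv ℝ ψ z a := by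
        congr 1
        exact integral_congr_ae (Eventually.of_forall fun z => (h1 z).symm)

end NearKernel

/-! ### The near part of the force potential -/

section NearPart

open NewtonPotentialHolder

variable {r₀ r₁ : ℝ} {f : EuclideanSpace ℝ (Fin 3) → EuclideanSpace ℝ (Fin 3)}

/-- **The near part** `Φ₀[f](x) = ∫ DΓ₀(z)(f(x - z)) dz = Σⱼ ∫ ∂ⱼΓ₀(z) fⱼ(x - z) dz` of the
force potential (cutoff radii `r₀ < r₁`). [folklore] -/
def nearPart (r₀ r₁ : ℝ) (f : EuclideanSpace ℝ (Fin 3) → EuclideanSpace ℝ (Fin 3))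
    (x : EuclideanSpace ℝ (Fin 3)) : ℝ :=
  ∑ j, ∫ z, fderiv ℝ (newtonNear r₀ r₁) z (EuclideanSpace.single j (1 : ℝ)) * f (x - z) j

/-- The coordinates of a `Cⁿ` field are `Cⁿ`. [folklore] -/
private theorem coord_contDiff {n : WithTop ℕ∞} (hf : ContDiff ℝ n f) (j : Fin 3) :
    ContDiff ℝ n fun y => f y j :=
  contDiff_euclidean.1 hf j

/-- **`Φ₀[f] ∈ Cⁿ` for `f ∈ Cⁿ`** (differentiation under the integral sign against the `L¹`
kernels `∂ⱼΓ₀`). [cite: GilbargTrudinger2001, Lemma 4.2] -/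
theorem contDiff_nearPart (h₀ : 0 < r₀) (h₁ : r₀ < r₁) (n : ℕ) (hf : ContDiff ℝ n f) :
    ContDiff ℝ n (nearPart r₀ r₁ f) := by
  unfold nearPart
  refine ContDiff.sum fun j _ => ?_
  exact contDiff_integral_smul_comp_sub (integrable_fderiv_newtonNear_apply h₀ h₁ _)
    (fun z hz => by rw [fderiv_newtonNear_eq_zero h₀.le h₁ hz]; rfl) n (coord_contDiff hf j)

/-- **`ΔΦ₀[f] = Σⱼ ∫ ∂ⱼΓ₀(z) Δfⱼ(x - z) dz`** for `f ∈ C²` (the Laplacian falls on `f`). [cite: GilbargTrudinger2001, Lemma 4.2] -/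
theorem laplacian_nearPart (h₀ : 0 < r₀) (h₁ : r₀ < r₁) (hf : ContDiff ℝ 2 f) (x : EuclideanSpace ℝ (Fin 3)) :
    Δ (nearPart r₀ r₁ f) x =
      ∑ j, ∫ z, fderiv ℝ (newtonNear r₀ r₁) z (EuclideanSpace.single j (1 : ℝ)) *
        (Δ fun y => f y j) (x - z) := by
  unfold nearPart
  rw [laplacian_finset_sum _ (fun j _ => ?_)]
  · refine Finset.sum_congr rfl fun j _ => ?_
    exact laplacian_integral_mul_comp_sub (integrable_fderiv_newtonNear_apply h₀ h₁ _)
      (fun z hz => by rw [fderiv_newtonNear_eq_zero h₀.le h₁ hz]; rfl) (coord_contDiff hf j) x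
  · exact contDiff_integral_smul_comp_sub (integrable_fderiv_newtonNear_apply h₀ h₁ _)
      (fun z hz => by rw [fderiv_newtonNear_eq_zero h₀.le h₁ hz]; rfl) 2 (coord_contDiff hf j)

/-- The divergence in coordinates: `div f = Σⱼ ∂ⱼfⱼ`. [folklore] -/
private theorem divergence_eq_sum_coord (hf : ContDiff ℝ 1 f) (y : EuclideanSpace ℝ (Fin 3)) :
    VectorCalculus.divergence f y =
      ∑ j, fderiv ℝ (fun w => f w j) y (EuclideanSpace.single j (1 : ℝ)) := by
  rw [divergence_eq_sum_inner_fderiv (EuclideanSpace.basisFun (Fin 3) ℝ) f y]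
  refine Finset.sum_congr rfl fun j _ => ?_
  rw [EuclideanSpace.basisFun_apply]
  have hd : DifferentiableAt ℝ f y := (hf.differentiable one_ne_zero) y
  have e : fderiv ℝ (fun w => f w j) y = (EuclideanSpace.proj (𝕜 := ℝ) j).comp (fderiv ℝ f y) := by
    rw [show (fun w => f w j) = (EuclideanSpace.proj (𝕜 := ℝ) j) ∘ f from rfl,
      fderiv_comp _ (EuclideanSpace.proj (𝕜 := ℝ) j).differentiableAt hd,
      (EuclideanSpace.proj (𝕜 := ℝ) j).fderiv]
  rw [e, ContinuousLinearMap.comp_apply]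
  have : ⟪EuclideanSpace.single j (1 : ℝ), fderiv ℝ f y (EuclideanSpace.single j 1)⟫ =
      (fderiv ℝ f y (EuclideanSpace.single j 1)) j := by
    simpa using EuclideanSpace.inner_single_left j (1 : ℝ) (fderiv ℝ f y (EuclideanSpace.single j 1))
  rw [this]
  rfl

/-- **The Laplacian of the near part**:
`ΔΦ₀[f](x) = div f(x) - Σⱼ ∫ ∂ⱼλ(z) fⱼ(x - z) dz` for `f ∈ C³` (integration by parts against
`Γ₀`, `Σⱼ∂ⱼΔfⱼ = Δ div f`, the localised Green identity `∫ Γ₀ Δφ = φ(0) - ∫ λφ`, and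
integration by parts against the smooth `λ = ΔΓ∞`). [cite: GilbargTrudinger2001, (2.17) with Lemma 4.1] -/
theorem laplacian_nearPart_eq (h₀ : 0 < r₀) (h₁ : r₀ < r₁) (hf : ContDiff ℝ 3 f) (x : EuclideanSpace ℝ (Fin 3)) :
    Δ (nearPart r₀ r₁ f) x =
      VectorCalculus.divergence f x -
        ∑ j, ∫ z, fderiv ℝ (newtonFarLaplacian r₀ r₁) z (EuclideanSpace.single j (1 : ℝ)) * f (x - z) j := by
  have hf2 : ContDiff ℝ 2 f := hf.of_le (by norm_num)
  have hf1 : ContDiff ℝ 1 f := hf.of_le (by norm_num)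
  -- coordinates `gⱼ = fⱼ` and their first partials `hⱼ = ∂ⱼfⱼ`
  set g : Fin 3 → EuclideanSpace ℝ (Fin 3) → ℝ := fun j y => f y j with hg
  have hg3 : ∀ j, ContDiff ℝ 3 (g j) := fun j => coord_contDiff hf j
  have hg2 : ∀ j, ContDiff ℝ 2 (g j) := fun j => (hg3 j).of_le (by norm_num)
  have hg1 : ∀ j, ContDiff ℝ 1 (g j) := fun j => (hg3 j).of_le (by norm_num)
  set h : Fin 3 → EuclideanSpace ℝ (Fin 3) → ℝ :=
    fun j y => fderiv ℝ (g j) y (EuclideanSpace.single j (1 : ℝ)) with hh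
  have hh2 : ∀ j, ContDiff ℝ 2 (h j) := fun j =>
    ((hg3 j).fderiv_right (m := 2) le_rfl).clm_apply contDiff_const
  -- `H = Σⱼ hⱼ = div f`
  set H : EuclideanSpace ℝ (Fin 3) → ℝ := fun y => ∑ j, h j y with hH
  have hH2 : ContDiff ℝ 2 H := ContDiff.sum fun j _ => hh2 j
  have hHdiv : ∀ y, H y = VectorCalculus.divergence f y := fun y => by
    rw [hH, divergence_eq_sum_coord hf1 y]
  -- Step 1: `Δ` under the integral, then IBP against `Γ₀`, then `∂ⱼΔ = Δ∂ⱼ`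
  rw [laplacian_nearPart h₀ h₁ hf2 x]
  have step1 : ∀ j, ∫ z, fderiv ℝ (newtonNear r₀ r₁) z (EuclideanSpace.single j (1 : ℝ)) *
      (Δ fun y => f y j) (x - z) = ∫ z, newtonNear r₀ r₁ z * (Δ (h j)) (x - z) := by
    intro j
    have hψ : ContDiff ℝ 1 fun z => (Δ (g j)) (x - z) :=
      (contDiff_laplacian (n := 1) (by exact_mod_cast hg3 j)).comp (contDiff_const.sub contDiff_id)
    have := integral_fderiv_newtonNear_mul h₀ h₁ hψ (EuclideanSpace.single j (1 : ℝ))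
    rw [show (fun y => f y j) = g j from rfl, this, ← integral_neg]
    refine integral_congr_ae (Eventually.of_forall fun z => ?_)
    show -(newtonNear r₀ r₁ z * fderiv ℝ (fun z => (Δ (g j)) (x - z)) z (EuclideanSpace.single j (1 : ℝ))) =
      newtonNear r₀ r₁ z * (Δ (h j)) (x - z)
    rw [fderiv_comp_const_sub, _root_.neg_apply, fderiv_laplacian_apply (hg3 j)]
    ring
  simp_rw [step1]
  -- Step 2: sum inside the integral: `Σⱼ Γ₀ Δhⱼ(x - ·) = Γ₀ ΔH(x - ·)`
  have iΓ₀ : ∀ j, Integrable (fun z => newtonNear r₀ r₁ z * (Δ (h j)) (x - z))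
      (volume : Measure (EuclideanSpace ℝ (Fin 3))) := fun j =>
    integrable_mul_of_vanishing (integrable_newtonNear h₀.le h₁)
      (fun z hz => newtonNear_eq_zero h₀.le h₁ hz.le)
      ((continuous_laplacian (hh2 j)).comp (continuous_const.sub continuous_id))
  rw [← integral_finsetSum _ fun j _ => iΓ₀ j]
  have step2 : ∀ z, ∑ j, newtonNear r₀ r₁ z * (Δ (h j)) (x - z) =
      newtonNear r₀ r₁ z * (Δ fun w => H (x - w)) z := by
    intro z
    rw [laplacian_comp_const_sub, ← Finset.mul_sum]
    congr 1
    rw [hH]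
    exact (laplacian_finset_sum _ (fun j _ => hh2 j) (x - z)).symm
  simp_rw [step2]
  -- Step 3: the localised Green identity
  have hφ : ContDiff ℝ 2 fun w => H (x - w) := hH2.comp (contDiff_const.sub contDiff_id)
  rw [integral_newtonNear_mul_laplacian h₀ h₁ hφ, sub_zero, hHdiv]
  -- Step 4: `∫ λ(z) H(x - z) dz = Σⱼ ∫ ∂ⱼλ(z) fⱼ(x - z) dz`
  congr 1
  have hlam1 : ContDiff ℝ 1 (newtonFarLaplacian r₀ r₁) := contDiff_newtonFarLaplacian h₀ h₁
  have hlamc : HasCompactSupport (newtonFarLaplacian r₀ r₁) := hasCompactSupport_newtonFarLaplacian h₀.le h₁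
  have ilam : ∀ j, Integrable (fun z => newtonFarLaplacian r₀ r₁ z * h j (x - z))
      (volume : Measure (EuclideanSpace ℝ (Fin 3))) := fun j =>
    (hlam1.continuous.mul ((hh2 j).continuous.comp (continuous_const.sub continuous_id)))
      |>.integrable_of_hasCompactSupport hlamc.mul_right
  have e4 : ∀ z, newtonFarLaplacian r₀ r₁ z * H (x - z) =
      ∑ j, newtonFarLaplacian r₀ r₁ z * h j (x - z) := fun z => by rw [hH, Finset.mul_sum]
  simp_rw [e4]
  rw [integral_finsetSum _ fun j _ => ilam j]
  refine Finset.sum_congr rfl fun j _ => ?_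
  rw [integral_fderiv_mul_comp_sub hlam1 hlamc (hg1 j) x (EuclideanSpace.single j (1 : ℝ))]

end NearPart

/-! ### Assembly: `Φ[f] = Φ₀[f] + Φ∞[f]`, `Φ[f] ∈ C²`, `ΔΦ[f] = ∇·f` -/

section Assembly

variable {f : EuclideanSpace ℝ (Fin 3) → EuclideanSpace ℝ (Fin 3)}

/-- **The near/far representation of the force potential** at cutoff radii `(1, 2)`:
`Φ[f] = Φ₀[f] + Φ∞[f]`. [folklore] -/
def potential (f : EuclideanSpace ℝ (Fin 3) → EuclideanSpace ℝ (Fin 3)) (x : EuclideanSpace ℝ (Fin 3)) : ℝ :=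
  nearPart 1 2 f x + farPart 1 2 f x

/-- The Laplacian of a sum of two `C²` functions. [folklore] -/
private theorem laplacian_add' {F G : EuclideanSpace ℝ (Fin 3) → ℝ} (hF : ContDiff ℝ 2 F)
    (hG : ContDiff ℝ 2 G) (x : EuclideanSpace ℝ (Fin 3)) :
    Δ (fun x => F x + G x) x = Δ F x + Δ G x := by
  have h := laplacian_finset_sum (Finset.univ : Finset (Fin 2)) (F := ![F, G])
    (fun i _ => by fin_cases i <;> simpa) x
  simpa [Fin.sum_univ_two] using h

/-- **`Φ[f] ∈ C²`** for `f ∈ C²(ℝ³; ℝ³) ∩ L²`. [cite: GilbargTrudinger2001, Lemma 4.2] -/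
theorem contDiff_potential (hf : ContDiff ℝ 2 f) (hf2 : MemLp f 2 volume) : ContDiff ℝ 2 (potential f) :=
  (contDiff_nearPart one_pos one_lt_two 2 (by exact_mod_cast hf)).add
    (contDiff_farPart one_pos one_lt_two hf.continuous hf2)

/-- **`ΔΦ[f] = ∇·f`** for `f ∈ C³(ℝ³; ℝ³) ∩ L²`: the `λ`-terms of the near and far parts
cancel after the substitution `z = x - y`. [cite: GilbargTrudinger2001, (2.17) with Lemma 4.2] -/
theorem laplacian_potential (hf : ContDiff ℝ 3 f) (hf2 : MemLp f 2 volume) (x : EuclideanSpace ℝ (Fin 3)) :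
    Δ (potential f) x = VectorCalculus.divergence f x := by
  have hf2' : ContDiff ℝ 2 f := hf.of_le (by norm_num)
  have hN : ContDiff ℝ 2 (nearPart 1 2 f) := contDiff_nearPart one_pos one_lt_two 2 (by exact_mod_cast hf2')
  have hF : ContDiff ℝ 2 (farPart 1 2 f) := contDiff_farPart one_pos one_lt_two hf.continuous hf2
  rw [show potential f = fun x => nearPart 1 2 f x + farPart 1 2 f x from rfl, laplacian_add' hN hF,
    laplacian_nearPart_eq one_pos one_lt_two hf x, laplacian_farPart one_pos one_lt_two hf.continuous hf2 x]
  have e : ∀ j : Fin 3, (∫ y, fderiv ℝ (newtonFarLaplacian 1 2) (x - y) (EuclideanSpace.single j (1 : ℝ)) * f y j) =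
      ∫ z, fderiv ℝ (newtonFarLaplacian 1 2) z (EuclideanSpace.single j (1 : ℝ)) * f (x - z) j := by
    intro j
    have := integral_sub_left_eq_self
      (fun z => fderiv ℝ (newtonFarLaplacian 1 2) z (EuclideanSpace.single j (1 : ℝ)) * f (x - z) j)
      (volume : Measure (EuclideanSpace ℝ (Fin 3))) x
    simp only [sub_sub_cancel] at this
    exact this
  simp_rw [e]
  ring

/-! #### Identification with `forcePotential` -/

/-- Linearity of the kernel derivative in coordinates: `DΓ•(z)(v) = Σⱼ vⱼ DΓ•(z)(eⱼ)`. [folklore] -/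
private theorem clm_apply_eq_sum_coord (L : EuclideanSpace ℝ (Fin 3) →L[ℝ] ℝ) (v : EuclideanSpace ℝ (Fin 3)) :
    L v = ∑ j, L (EuclideanSpace.single j (1 : ℝ)) * v j := by
  conv_lhs => rw [← (EuclideanSpace.basisFun (Fin 3) ℝ).sum_repr v]
  rw [map_sum]
  refine Finset.sum_congr rfl fun j _ => ?_
  rw [EuclideanSpace.basisFun_repr, EuclideanSpace.basisFun_apply, map_smul, smul_eq_mul, mul_comm]

/-- Off the diagonal the force kernel is the gradient of the Newtonian kernel, split into its near
and far parts: `forceKernel z v = DΓ(z) v = DΓ₀(z) v + DΓ∞(z) v`, `z ≠ 0`. [cite: Tao2011, (9) p. 5] -/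
theorem forceKernel_eq_fderiv_add {z : EuclideanSpace ℝ (Fin 3)} (hz : z ≠ 0) (v : EuclideanSpace ℝ (Fin 3)) :
    forceKernel z v = fderiv ℝ (newtonNear 1 2) z v + fderiv ℝ (newtonFar 1 2) z v := by
  rw [forceKernel_eq_fin3, ← fderiv_newtonKernel_apply hz, fderiv_newtonNear_eq_sub one_pos one_lt_two hz,
    _root_.sub_apply]
  ring

/-- **`Δ⁻¹∇·f = Φ₀[f] + Φ∞[f]`**: for `f` continuous and square integrable, the force potential
`forcePotential f x = ∫ ⟨x - y, f(y)⟩/(4π|x - y|³) dy` (an absolutely convergent integral) equals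
the near/far representation. [cite: Tao2011, (9) p. 5] -/
theorem forcePotential_eq_potential (hf : Continuous f) (hf2 : MemLp f 2 volume) :
    forcePotential f = potential f := by
  funext x
  -- the far integrands
  have hfar : ∀ j, Integrable (fun y => fderiv ℝ (newtonFar 1 2) (x - y) (EuclideanSpace.single j (1 : ℝ)) * f y j)
      (volume : Measure (EuclideanSpace ℝ (Fin 3))) := by
    intro j
    obtain ⟨hK, ⟨M₀, hM₀⟩, -, -⟩ := farKernel_tail one_pos one_lt_two j
    obtain ⟨hgc, hg⟩ := coord_continuous_memLp hf hf2 j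
    exact integrable_tail_mul hK.continuous hM₀ hgc hg x
  -- the near integrands (in the `y`-variable)
  have hnear : ∀ j, Integrable (fun y => fderiv ℝ (newtonNear 1 2) (x - y) (EuclideanSpace.single j (1 : ℝ)) * f y j)
      (volume : Measure (EuclideanSpace ℝ (Fin 3))) := by
    intro j
    have h := integrable_mul_of_vanishing (integrable_fderiv_newtonNear_apply one_pos one_lt_two
      (EuclideanSpace.single j (1 : ℝ)))
      (fun z hz => by rw [fderiv_newtonNear_eq_zero zero_le_one one_lt_two hz]; rfl)
      ((coord_continuous_memLp hf hf2 j).1.comp (continuous_const.sub continuous_id) : Continuous fun z => f (x - z) j)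
    have := h.comp_sub_left x
    simpa only [Function.comp_apply, sub_sub_cancel] using this
  -- a.e. splitting of the integrand
  have hae : ∀ᵐ y ∂(volume : Measure (EuclideanSpace ℝ (Fin 3))), y ≠ x := by
    simp [ae_iff, measure_singleton]
  have hsplit : (fun y => forceKernel (x - y) (f y)) =ᵐ[volume]
      fun y => (∑ j, fderiv ℝ (newtonNear 1 2) (x - y) (EuclideanSpace.single j (1 : ℝ)) * f y j) +
        ∑ j, fderiv ℝ (newtonFar 1 2) (x - y) (EuclideanSpace.single j (1 : ℝ)) * f y j := by
    filter_upwards [hae] with y hy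
    rw [forceKernel_eq_fderiv_add (sub_ne_zero.2 (Ne.symm hy)), clm_apply_eq_sum_coord,
      clm_apply_eq_sum_coord (fderiv ℝ (newtonFar 1 2) (x - y))]
  rw [forcePotential, integral_congr_ae hsplit,
    integral_add (integrable_finsetSum _ fun j _ => hnear j) (integrable_finsetSum _ fun j _ => hfar j),
    integral_finsetSum _ fun j _ => hnear j, integral_finsetSum _ fun j _ => hfar j, potential, nearPart, farPart]
  congr 1
  refine Finset.sum_congr rfl fun j _ => ?_
  have := integral_sub_left_eq_self
    (fun z => fderiv ℝ (newtonNear 1 2) z (EuclideanSpace.single j (1 : ℝ)) * f (x - z) j)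
    (volume : Measure (EuclideanSpace ℝ (Fin 3))) x
  simp only [sub_sub_cancel] at this
  exact this

end Assembly

end ForcePotential

/-! ## The force potential: regularity and the Poisson equation -/

section Main

open ForcePotential

variable {f : EuclideanSpace ℝ (Fin 3) → EuclideanSpace ℝ (Fin 3)}

/-- **`Δ⁻¹∇·f ∈ C²(ℝ³)`** for a force slice `f ∈ C²(ℝ³; ℝ³) ∩ L²` (Tao 2011, (9): "`∇·f` is
the first derivative of an `L²_x(ℝ³)` function, so `Δ⁻¹∇·f` is well defined"; Gilbarg–Trudinger,
Lemma 4.2: second derivatives of Newtonian potentials). [cite: GilbargTrudinger2001, Lemma 4.2] -/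
theorem contDiff_forcePotential (hf : ContDiff ℝ 2 f) (hf2 : MemLp f 2 volume) :
    ContDiff ℝ 2 (forcePotential f) := by
  rw [forcePotential_eq_potential hf.continuous hf2]
  exact contDiff_potential hf hf2

/-- **The Poisson equation `Δ(Δ⁻¹∇·f) = ∇·f`** pointwise on `ℝ³`, for `f ∈ C³(ℝ³; ℝ³) ∩ L²`
(Gilbarg–Trudinger (2.17) and Lemma 4.2, `Δ(Γ * g) = g`, organised through the near/far
splitting `Γ = Γ₀ + Γ∞` of the tree). With Tao's pressure Poisson equation (8),
`Δp = -∂ᵢ∂ⱼ(uᵢuⱼ) + ∇·f`, this is what makes `p - (-Δ⁻¹∂ᵢ∂ⱼ(uᵢuⱼ)) - Δ⁻¹∇·f` harmonic in the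
proof of Lemma 4.1 (i). [cite: GilbargTrudinger2001, (2.17) with Lemma 4.2] -/
theorem laplacian_forcePotential (hf : ContDiff ℝ 3 f) (hf2 : MemLp f 2 volume) (x : EuclideanSpace ℝ (Fin 3)) :
    Δ (forcePotential f) x = VectorCalculus.divergence f x := by
  rw [forcePotential_eq_potential hf.continuous hf2]
  exact laplacian_potential hf hf2 x

end Main

end Literature.Analysis.FluidPDE

end
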